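import Literature.Analysis.PDE.SymmetricHyperbolicEnergy
import Literature.Analysis.PDE.CoordWordTame
import HarnessLib

/-!
# Whole-space sup and tame `L²` bounds for word derivatives of compositions `x ↦ F(h(x))`

Analytic layer of the energy method for quasilinear symmetric(-izable) hyperbolic systems on the
WHOLE space `ℝⁿ` (Kato–Majda–Taylor local existence; used by the programme discharging Rauch's
Local Existence Theorem, `Literature/Barriers/AtomisticToContinuum/NoBVEstimatesMultiD*.lean`).
The tree's `CoordWordTame.lean` proves the crude Moser-type bounds for `x ↦ F(x, h(x))` on a
COMPACT set `K` (constants depending on `K`, e.g. through `vol K` at order zero). For the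
`Hᵐ(ℝⁿ)` energy estimates of the Friedrichs-regularised quasilinear flow one needs the same
bounds on all of `ℝⁿ`; they hold, with constants independent of the domain, as soon as the
nonlinearity `F : V → G` does not depend on `x` and has GLOBALLY bounded derivatives of every
order (e.g. `F` smooth and constant outside a compact set — the cut-off coefficients of a
quasilinear system near a constant state), because every word derivative of positive length of
`F ∘ h` is a sum of products each containing at least one derivative of `h`:

* `memLp_bilinear_of_bdd_left` / `memLp_bilinear_of_bdd_right` — a continuous bilinear image of a
  bounded continuous factor and an `L²` factor is in `L²`, with the product bound;
* `exists_sup_bound_cwd_comp_whole` — **sup bounds**: if `‖∂_c h‖_∞ ≤ R` for `1 ≤ |c| ≤ n` then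
  `‖∂_v (F ∘ h)‖_∞ ≤ C(n, F, R)` for `|v| ≤ n`;
* `exists_tame_bound_cwd_comp_whole` — **tame `L²(ℝⁿ)` bounds**: if moreover
  `‖∂_c h‖_{L²} ≤ Y` for `1 ≤ |c| ≤ n` and the sup control holds for `1 ≤ |c| ≤ q` with
  `n ≤ 2q + 1`, then `∂_v (F ∘ h) ∈ L²` with `‖∂_v (F ∘ h)‖_{L²} ≤ C · Y` for `1 ≤ |v| ≤ n` —
  LINEAR in `Y`, with NO additive constant (Taylor, *PDE III*, Ch. 13, §3, Prop. 3.9 in the crude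
  form "the factor with fewer derivatives goes in the sup norm", whole-space version).

Both are proved by induction on `n` (generalizing `F`) through the chain rule
`∂_i (F ∘ h) = (DF ∘ h) · ∂_i h` and the Leibniz expansion over splittings (`cwd_bilinear`).

Everything is proved; no named fact and no `sorry` is introduced.

## References

* M. E. Taylor, *Partial differential equations III. Nonlinear equations*, 2nd ed., Springer 2011,
  Ch. 13, §3, Props. 3.6–3.9 (Moser-type estimates). [TaylorPDEIII2011]
* A. Majda, *Compressible Fluid Flow and Systems of Conservation Laws in Several Space
  Variables*, Springer 1984, Ch. 2, Prop. 2.1–2.2. [Majda1984]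
-/

noncomputable section

open MeasureTheory Set Function Filter
open scoped ContDiff Topology ENNReal

namespace Literature.Analysis.PDE

open Literature.Analysis.FunctionSpaces

universe u

variable {ι : Type*} [Fintype ι] [DecidableEq ι]

/-! ### Bilinear images of a bounded factor and an `L²` factor -/

section Bilinear

variable {F₁ : Type*} [NormedAddCommGroup F₁] [NormedSpace ℝ F₁]
variable {F₂ : Type*} [NormedAddCommGroup F₂] [NormedSpace ℝ F₂]
variable {F₃ : Type*} [NormedAddCommGroup F₃] [NormedSpace ℝ F₃]

omit [DecidableEq ι] in
/-- `x ↦ B(f x, g x)` is in `L²` with `‖B(f, g)‖₂ ≤ ‖B‖ A ‖g‖₂` when `f` is continuous with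
`‖f‖ ≤ A` and `g ∈ L²` is continuous. [folklore] -/
theorem memLp_bilinear_of_bdd_left (B : F₁ →L[ℝ] F₂ →L[ℝ] F₃) {f : EuclideanSpace ℝ ι → F₁}
    {g : EuclideanSpace ℝ ι → F₂} (hf : Continuous f) (hg : Continuous g)
    (hg2 : MemLp g 2 (volume : Measure (EuclideanSpace ℝ ι))) {A : ℝ} (hA : 0 ≤ A)
    (hfA : ∀ x, ‖f x‖ ≤ A) :
    MemLp (fun x => B (f x) (g x)) 2 (volume : Measure (EuclideanSpace ℝ ι)) ∧
      l2norm (fun x => B (f x) (g x)) ≤ ‖B‖ * A * l2norm g := by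
  refine memLp_and_l2norm_le_of_le ((B.continuous.comp hf).clm_apply hg) hg2 (by positivity)
    fun x => ?_
  calc ‖B (f x) (g x)‖ ≤ ‖B‖ * ‖f x‖ * ‖g x‖ := B.le_opNorm₂ (f x) (g x)
    _ ≤ ‖B‖ * A * ‖g x‖ := by gcongr; exact hfA x

omit [DecidableEq ι] in
/-- `x ↦ B(f x, g x)` is in `L²` with `‖B(f, g)‖₂ ≤ ‖B‖ A ‖f‖₂` when `g` is continuous with
`‖g‖ ≤ A` and `f ∈ L²` is continuous. [folklore] -/
theorem memLp_bilinear_of_bdd_right (B : F₁ →L[ℝ] F₂ →L[ℝ] F₃) {f : EuclideanSpace ℝ ι → F₁}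
    {g : EuclideanSpace ℝ ι → F₂} (hf : Continuous f) (hg : Continuous g)
    (hf2 : MemLp f 2 (volume : Measure (EuclideanSpace ℝ ι))) {A : ℝ} (hA : 0 ≤ A)
    (hgA : ∀ x, ‖g x‖ ≤ A) :
    MemLp (fun x => B (f x) (g x)) 2 (volume : Measure (EuclideanSpace ℝ ι)) ∧
      l2norm (fun x => B (f x) (g x)) ≤ ‖B‖ * A * l2norm f := by
  refine memLp_and_l2norm_le_of_le ((B.continuous.comp hf).clm_apply hg) hf2 (by positivity)
    fun x => ?_
  calc ‖B (f x) (g x)‖ ≤ ‖B‖ * ‖f x‖ * ‖g x‖ := B.le_opNorm₂ (f x) (g x)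
    _ ≤ ‖B‖ * ‖f x‖ * A := by gcongr; exact hgA x
    _ = ‖B‖ * A * ‖f x‖ := by ring

end Bilinear

/-! ### The chain rule in word form and the derivative bounds of `DF` -/

section Chain

variable {V : Type u} [NormedAddCommGroup V] [NormedSpace ℝ V]
variable {G : Type u} [NormedAddCommGroup G] [NormedSpace ℝ G]

omit [DecidableEq ι] in
/-- **Chain rule, word form**: `∂_i (F ∘ h) = (DF ∘ h) (∂_i h)`, the right-hand side written
through the continuous bilinear application map `id : (V →L G) →L (V →L G)`. [folklore] -/
theorem fderiv_comp_apply_bv_eq {F : V → G} (hF : ContDiff ℝ ∞ F) {h : EuclideanSpace ℝ ι → V}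
    (hh : ContDiff ℝ ∞ h) (i : ι) :
    (fun x => fderiv ℝ (fun y => F (h y)) x (bv i)) =
      fun x => (ContinuousLinearMap.id ℝ (V →L[ℝ] G)) (fderiv ℝ F (h x)) (cwd [i] h x) := by
  funext x
  have hF' : DifferentiableAt ℝ F (h x) := (hF.differentiable (by simp)) _
  have hh' : DifferentiableAt ℝ h x := (hh.differentiable (by simp)) x
  have hc : HasFDerivAt (fun y => F (h y)) ((fderiv ℝ F (h x)).comp (fderiv ℝ h x)) x :=
    hF'.hasFDerivAt.comp x hh'.hasFDerivAt
  rw [hc.fderiv]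
  simp

omit [DecidableEq ι] in
/-- `∂_{v i} (F ∘ h) = Σ_{(a, c) ∈ splittings v} (∂_a (DF ∘ h)) (∂_c ∂_i h)` (chain rule, then
Leibniz). [cite: TaylorPDEIII2011, Ch. 13, §3, (3.1.16)] -/
theorem cwd_append_singleton_comp_eq {F : V → G} (hF : ContDiff ℝ ∞ F)
    {h : EuclideanSpace ℝ ι → V} (hh : ContDiff ℝ ∞ h) (v : List ι) (i : ι) :
    cwd (v ++ [i]) (fun y => F (h y)) = fun x => ((splittings v).map fun p =>
      (ContinuousLinearMap.id ℝ (V →L[ℝ] G)) (cwd p.1 (fun y => fderiv ℝ F (h y)) x)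
        (cwd p.2 (cwd [i] h) x)).sum := by
  rw [cwd_append_singleton, fderiv_comp_apply_bv_eq hF hh i]
  have hA : ContDiff ℝ ∞ fun y => fderiv ℝ F (h y) :=
    (hF.fderiv_right (m := ∞) (by norm_cast)).comp hh
  exact cwd_bilinear _ hA (contDiff_cwd hh [i]) v

/-- `DF` is smooth if `F` is. [folklore] -/
theorem contDiff_fderiv_of_contDiff {F : V → G} (hF : ContDiff ℝ ∞ F) :
    ContDiff ℝ ∞ (fderiv ℝ F) :=
  hF.fderiv_right (m := ∞) (by norm_cast)

/-- Global bounds on all derivatives of `F` pass to `DF`. [folklore] -/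
theorem bounds_fderiv_of_bounds {F : V → G}
    (hK : ∀ i : ℕ, ∃ K : ℝ, ∀ y, ‖iteratedFDeriv ℝ i F y‖ ≤ K) :
    ∀ i : ℕ, ∃ K : ℝ, ∀ y, ‖iteratedFDeriv ℝ i (fderiv ℝ F) y‖ ≤ K := by
  intro i
  obtain ⟨K, hKb⟩ := hK (i + 1)
  exact ⟨K, fun y => by rw [norm_iteratedFDeriv_fderiv]; exact hKb y⟩

/-- The order-zero bound `‖F(y)‖ ≤ K₀` (with `K₀ ≥ 0`). [folklore] -/
theorem exists_bound_zero_of_bounds {F : V → G}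
    (hK : ∀ i : ℕ, ∃ K : ℝ, ∀ y, ‖iteratedFDeriv ℝ i F y‖ ≤ K) :
    ∃ K : ℝ, 0 ≤ K ∧ ∀ y, ‖F y‖ ≤ K := by
  obtain ⟨K, hKb⟩ := hK 0
  refine ⟨max K 0, le_max_right _ _, fun y => ?_⟩
  have := hKb y
  rw [norm_iteratedFDeriv_zero] at this
  exact this.trans (le_max_left _ _)

/-- The order-one bound `‖DF(y)‖ ≤ K₁` (with `K₁ ≥ 0`). [folklore] -/
theorem exists_bound_fderiv_of_bounds {F : V → G}
    (hK : ∀ i : ℕ, ∃ K : ℝ, ∀ y, ‖iteratedFDeriv ℝ i F y‖ ≤ K) :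
    ∃ K : ℝ, 0 ≤ K ∧ ∀ y, ‖fderiv ℝ F y‖ ≤ K := by
  obtain ⟨K, hK0, hKb⟩ := exists_bound_zero_of_bounds (bounds_fderiv_of_bounds hK)
  exact ⟨K, hK0, hKb⟩

end Chain

/-! ### Sup bounds on the whole space -/

section Sup

variable {V : Type u} [NormedAddCommGroup V] [NormedSpace ℝ V]

omit [DecidableEq ι] in
/-- **Whole-space sup bounds for word derivatives of a composition** (Taylor, *PDE III*,
Ch. 13, §3, qualitative part of the Moser estimates, for an `x`-independent nonlinearity with
globally bounded derivatives): for `F : V → G` smooth with `‖DⁱF‖ ≤ Kᵢ` on `V` for every `i`,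
an order `n` and a radius `R` there is `C ≥ 0` such that `‖∂_v (F ∘ h)(x)‖ ≤ C` for all `x`,
`|v| ≤ n` and all smooth `h : ℝⁿ → V` with `‖∂_c h(x)‖ ≤ R` for all `x` and `1 ≤ |c| ≤ n`
(no bound on `h` itself is needed). [cite: TaylorPDEIII2011, Ch. 13, §3, Prop. 3.9] -/
theorem exists_sup_bound_cwd_comp_whole (n : ℕ) :
    ∀ {G : Type u} [NormedAddCommGroup G] [NormedSpace ℝ G] {F : V → G},
      ContDiff ℝ ∞ F → (∀ i : ℕ, ∃ K : ℝ, ∀ y, ‖iteratedFDeriv ℝ i F y‖ ≤ K) → ∀ R : ℝ,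
      ∃ C : ℝ, 0 ≤ C ∧ ∀ h : EuclideanSpace ℝ ι → V, ContDiff ℝ ∞ h →
        (∀ c : List ι, 1 ≤ c.length → c.length ≤ n → ∀ x, ‖cwd c h x‖ ≤ R) →
        ∀ v : List ι, v.length ≤ n → ∀ x, ‖cwd v (fun y => F (h y)) x‖ ≤ C := by
  induction n with
  | zero =>
    intro G _ _ F hF hK R
    obtain ⟨K₀, hK₀0, hK₀⟩ := exists_bound_zero_of_bounds hK
    refine ⟨K₀, hK₀0, fun h _ _ v hv x => ?_⟩
    have hv0 : v = [] := List.eq_nil_of_length_eq_zero (Nat.le_zero.1 hv)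
    subst hv0
    simpa using hK₀ (h x)
  | succ n ih =>
    intro G _ _ F hF hK R
    set Rp : ℝ := max R 0 with hRpdef
    have hRp : 0 ≤ Rp := le_max_right _ _
    obtain ⟨K₀, hK₀0, hK₀⟩ := exists_bound_zero_of_bounds hK
    -- sup bound at order `n` for `DF ∘ h`
    obtain ⟨C₂, hC₂0, hC₂⟩ :=
      ih (contDiff_fderiv_of_contDiff hF) (bounds_fderiv_of_bounds hK) Rp
    refine ⟨K₀ + 2 ^ n * (C₂ * Rp), by positivity, ?_⟩
    intro h hh hbd' v hv x
    have hbd : ∀ c : List ι, 1 ≤ c.length → c.length ≤ n + 1 → ∀ x, ‖cwd c h x‖ ≤ Rp :=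
      fun c hc1 hc x => (hbd' c hc1 hc x).trans (le_max_left _ _)
    have hbdn : ∀ c : List ι, 1 ≤ c.length → c.length ≤ n → ∀ x, ‖cwd c h x‖ ≤ Rp :=
      fun c hc1 hc => hbd c hc1 (hc.trans (Nat.le_succ n))
    rcases v.eq_nil_or_concat with rfl | ⟨v, i, rfl⟩
    · have h0 : ‖cwd [] (fun y => F (h y)) x‖ ≤ K₀ := by simpa using hK₀ (h x)
      have h2 : 0 ≤ 2 ^ n * (C₂ * Rp) := by positivity
      linarith
    · simp only [List.concat_eq_append, List.length_append, List.length_singleton,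
        Nat.succ_le_succ_iff] at hv ⊢
      rw [cwd_append_singleton_comp_eq hF hh v i]
      have e2 : ∀ p ∈ splittings v,
          ‖(ContinuousLinearMap.id ℝ (V →L[ℝ] G)) (cwd p.1 (fun y => fderiv ℝ F (h y)) x)
            (cwd p.2 (cwd [i] h) x)‖ ≤ C₂ * Rp := by
        intro p hp
        have hlen := length_add_length_of_mem_splittings hp
        have ha : p.1.length ≤ n := by omega
        rw [ContinuousLinearMap.id_apply]
        refine (ContinuousLinearMap.le_opNorm _ _).trans
          (mul_le_mul (hC₂ h hh hbdn p.1 ha x) ?_ (norm_nonneg _) hC₂0)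
        rw [← cwd_append]
        exact hbd (p.2 ++ [i]) (by simp) (by simp; omega) x
      have e3 : ‖((splittings v).map fun p =>
          (ContinuousLinearMap.id ℝ (V →L[ℝ] G)) (cwd p.1 (fun y => fderiv ℝ F (h y)) x)
            (cwd p.2 (cwd [i] h) x)).sum‖ ≤ 2 ^ n * (C₂ * Rp) := by
        refine (norm_list_sum_le _).trans ?_
        rw [List.map_map]
        have hlen : (splittings v).length ≤ 2 ^ n := by
          rw [length_splittings]
          exact Nat.pow_le_pow_right (by norm_num) hv
        calc ((splittings v).map (Norm.norm ∘ fun p =>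
              (ContinuousLinearMap.id ℝ (V →L[ℝ] G)) (cwd p.1 (fun y => fderiv ℝ F (h y)) x)
                (cwd p.2 (cwd [i] h) x))).sum
            ≤ ((splittings v).map fun _ => C₂ * Rp).sum :=
              List.sum_le_sum fun p hp => e2 p hp
          _ = (splittings v).length * (C₂ * Rp) := by
              rw [List.map_const', List.sum_replicate, nsmul_eq_mul]
          _ ≤ 2 ^ n * (C₂ * Rp) := by
              have : (0 : ℝ) ≤ C₂ * Rp := mul_nonneg hC₂0 hRp
              exact mul_le_mul_of_nonneg_right (by exact_mod_cast hlen) this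
      linarith

end Sup

/-! ### Tame `L²(ℝⁿ)` bounds on the whole space -/

section Tame

variable {V : Type u} [NormedAddCommGroup V] [NormedSpace ℝ V]

omit [DecidableEq ι] in
/-- **Whole-space tame `L²` bounds for word derivatives of a composition** (Taylor, *PDE III*,
Ch. 13, §3, crude Moser estimate, for an `x`-independent nonlinearity with globally bounded
derivatives): for `F : V → G` smooth with `‖DⁱF‖ ≤ Kᵢ` on `V` for every `i`, orders `n ≤ 2q + 1`
and a radius `R` there is `C ≥ 0` such that for every smooth `h : ℝⁿ → V` with
`‖∂_c h(x)‖ ≤ R` (`1 ≤ |c| ≤ q`, all `x`) and every `Y ≥ 0` with `∂_c h ∈ L²`,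
`‖∂_c h‖_{L²} ≤ Y` (`1 ≤ |c| ≤ n`): `∂_v (F ∘ h) ∈ L²(ℝⁿ)` and `‖∂_v (F ∘ h)‖_{L²} ≤ C · Y` for
all `1 ≤ |v| ≤ n` — linear in the top-order quantity `Y`, without additive constant (every
Leibniz term of a positive-length word derivative of `F ∘ h` carries a derivative of `h`; the
factor with at most `q` derivatives of `h`, or the `DF ∘ h`-factor with at most `n - q ≤ q`
derivatives, is put in the sup norm). [cite: TaylorPDEIII2011, Ch. 13, §3, Prop. 3.9] -/
theorem exists_tame_bound_cwd_comp_whole (n : ℕ) :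
    ∀ {G : Type u} [NormedAddCommGroup G] [NormedSpace ℝ G] {F : V → G},
      ContDiff ℝ ∞ F → (∀ i : ℕ, ∃ K : ℝ, ∀ y, ‖iteratedFDeriv ℝ i F y‖ ≤ K) →
      ∀ q : ℕ, n ≤ 2 * q + 1 → ∀ R : ℝ,
      ∃ C : ℝ, 0 ≤ C ∧ ∀ h : EuclideanSpace ℝ ι → V, ContDiff ℝ ∞ h →
        (∀ c : List ι, 1 ≤ c.length → c.length ≤ q → ∀ x, ‖cwd c h x‖ ≤ R) →
        ∀ Y : ℝ, 0 ≤ Y →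
        (∀ c : List ι, 1 ≤ c.length → c.length ≤ n →
          MemLp (cwd c h) 2 (volume : Measure (EuclideanSpace ℝ ι)) ∧ l2norm (cwd c h) ≤ Y) →
        ∀ v : List ι, 1 ≤ v.length → v.length ≤ n →
          MemLp (cwd v (fun y => F (h y))) 2 (volume : Measure (EuclideanSpace ℝ ι)) ∧
            l2norm (cwd v (fun y => F (h y))) ≤ C * Y := by
  induction n with
  | zero =>
    intro G _ _ F hF hK q hq R
    exact ⟨0, le_rfl, fun h _ _ Y _ _ v hv1 hv0 => by omega⟩
  | succ n ih =>
    intro G _ _ F hF hK q hq R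
    set Rp : ℝ := max R 0 with hRpdef
    have hRp : 0 ≤ Rp := le_max_right _ _
    have hF1 : ContDiff ℝ ∞ (fderiv ℝ F) := contDiff_fderiv_of_contDiff hF
    have hK1 := bounds_fderiv_of_bounds hK
    -- `‖DF‖ ≤ K₁`
    obtain ⟨K₁, hK₁0, hK₁⟩ := exists_bound_fderiv_of_bounds hK
    -- tame bound at order `n` for `DF ∘ h`
    obtain ⟨C₂, hC₂0, hC₂⟩ := ih hF1 hK1 q (by omega) Rp
    -- sup bound at order `q` for `DF ∘ h`
    obtain ⟨C₃, hC₃0, hC₃⟩ := exists_sup_bound_cwd_comp_whole (ι := ι) q hF1 hK1 Rp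
    set T : ℝ := K₁ + C₂ * Rp + C₃ with hTdef
    have hT0 : 0 ≤ T := by positivity
    refine ⟨2 ^ n * T, by positivity, ?_⟩
    intro h hh hbd' Y hY hL2 v hv1 hv
    have hbd : ∀ c : List ι, 1 ≤ c.length → c.length ≤ q → ∀ x, ‖cwd c h x‖ ≤ Rp :=
      fun c hc1 hc x => (hbd' c hc1 hc x).trans (le_max_left _ _)
    have hL2n : ∀ c : List ι, 1 ≤ c.length → c.length ≤ n →
        MemLp (cwd c h) 2 (volume : Measure (EuclideanSpace ℝ ι)) ∧ l2norm (cwd c h) ≤ Y :=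
      fun c hc1 hc => hL2 c hc1 (hc.trans (Nat.le_succ n))
    rcases v.eq_nil_or_concat with rfl | ⟨v, i, rfl⟩
    · simp at hv1
    · simp only [List.concat_eq_append, List.length_append, List.length_singleton,
        Nat.succ_le_succ_iff] at hv ⊢
      rw [cwd_append_singleton_comp_eq hF hh v i]
      -- continuity of the factors
      have hA : ContDiff ℝ ∞ fun y => fderiv ℝ F (h y) := hF1.comp hh
      have hci : ContDiff ℝ ∞ (cwd [i] h) := contDiff_cwd hh [i]
      -- every splitting term is in `L²` with norm `≤ T * Y`
      have e2 : ∀ p ∈ splittings v,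
          MemLp (fun x => (ContinuousLinearMap.id ℝ (V →L[ℝ] G))
            (cwd p.1 (fun y => fderiv ℝ F (h y)) x) (cwd p.2 (cwd [i] h) x)) 2
              (volume : Measure (EuclideanSpace ℝ ι)) ∧
          l2norm (fun x => (ContinuousLinearMap.id ℝ (V →L[ℝ] G))
            (cwd p.1 (fun y => fderiv ℝ F (h y)) x) (cwd p.2 (cwd [i] h) x)) ≤ T * Y := by
        intro p hp
        have hlen := length_add_length_of_mem_splittings hp
        have hidn : ‖ContinuousLinearMap.id ℝ (V →L[ℝ] G)‖ ≤ 1 := ContinuousLinearMap.norm_id_le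
        have hc1 : ContDiff ℝ ∞ (cwd p.1 (fun y => fderiv ℝ F (h y))) := contDiff_cwd hA p.1
        have hc2 : ContDiff ℝ ∞ (cwd p.2 (cwd [i] h)) := contDiff_cwd hci p.2
        -- the `h`-factor is `∂_{c i} h`, of length `|c| + 1 ∈ [1, n + 1]`
        have hfac : cwd p.2 (cwd [i] h) = cwd (p.2 ++ [i]) h := by rw [← cwd_append]
        have hfacL2 : MemLp (cwd p.2 (cwd [i] h)) 2 (volume : Measure (EuclideanSpace ℝ ι)) ∧
            l2norm (cwd p.2 (cwd [i] h)) ≤ Y := by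
          rw [hfac]; exact hL2 (p.2 ++ [i]) (by simp) (by simp; omega)
        by_cases hp1 : p.1 = []
        · -- no derivative on `DF ∘ h`: sup on it (`≤ K₁`), `L²` on the `h`-factor
          have hsup : ∀ x, ‖cwd p.1 (fun y => fderiv ℝ F (h y)) x‖ ≤ K₁ := fun x => by
            rw [hp1]; simpa using hK₁ (h x)
          obtain ⟨hm, hle⟩ := memLp_bilinear_of_bdd_left (ContinuousLinearMap.id ℝ (V →L[ℝ] G))
            hc1.continuous hc2.continuous hfacL2.1 hK₁0 hsup
          refine ⟨hm, hle.trans ?_⟩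
          calc ‖ContinuousLinearMap.id ℝ (V →L[ℝ] G)‖ * K₁ * l2norm (cwd p.2 (cwd [i] h))
              ≤ 1 * K₁ * Y :=
                mul_le_mul (mul_le_mul_of_nonneg_right hidn hK₁0) hfacL2.2 (l2norm_nonneg _)
                  (by positivity)
            _ ≤ T * Y := by
                apply mul_le_mul_of_nonneg_right _ hY
                rw [one_mul, hTdef]
                nlinarith [mul_nonneg hC₂0 hRp]
        · by_cases hc : p.2.length + 1 ≤ q
          · -- few derivatives on the `h`-factor: sup on it, tame `L²` on `∂_a (DF ∘ h)`
            have ha1 : 1 ≤ p.1.length :=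
              Nat.one_le_iff_ne_zero.mpr fun h0 => hp1 (List.eq_nil_of_length_eq_zero h0)
            have ha : p.1.length ≤ n := by omega
            obtain ⟨hm1, hle1⟩ := hC₂ h hh hbd Y hY hL2n p.1 ha1 ha
            have hsup : ∀ x, ‖cwd p.2 (cwd [i] h) x‖ ≤ Rp := fun x => by
              rw [hfac]; exact hbd (p.2 ++ [i]) (by simp) (by simpa using hc) x
            obtain ⟨hm, hle⟩ := memLp_bilinear_of_bdd_right (ContinuousLinearMap.id ℝ (V →L[ℝ] G))
              hc1.continuous hc2.continuous hm1 hRp hsup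
            refine ⟨hm, hle.trans ?_⟩
            calc ‖ContinuousLinearMap.id ℝ (V →L[ℝ] G)‖ * Rp *
                  l2norm (cwd p.1 (fun y => fderiv ℝ F (h y)))
                ≤ 1 * Rp * (C₂ * Y) :=
                  mul_le_mul (mul_le_mul_of_nonneg_right hidn hRp) hle1 (l2norm_nonneg _)
                    (by positivity)
              _ = (C₂ * Rp) * Y := by ring
              _ ≤ T * Y := by
                  apply mul_le_mul_of_nonneg_right _ hY
                  rw [hTdef]
                  nlinarith
          · -- many derivatives on the `h`-factor: `|a| ≤ n - q ≤ q`, sup on `∂_a (DF ∘ h)`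
            have ha : p.1.length ≤ q := by omega
            have hsup : ∀ x, ‖cwd p.1 (fun y => fderiv ℝ F (h y)) x‖ ≤ C₃ :=
              fun x => hC₃ h hh hbd p.1 ha x
            obtain ⟨hm, hle⟩ := memLp_bilinear_of_bdd_left (ContinuousLinearMap.id ℝ (V →L[ℝ] G))
              hc1.continuous hc2.continuous hfacL2.1 hC₃0 hsup
            refine ⟨hm, hle.trans ?_⟩
            calc ‖ContinuousLinearMap.id ℝ (V →L[ℝ] G)‖ * C₃ * l2norm (cwd p.2 (cwd [i] h))
                ≤ 1 * C₃ * Y :=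
                  mul_le_mul (mul_le_mul_of_nonneg_right hidn hC₃0) hfacL2.2 (l2norm_nonneg _)
                    (by positivity)
              _ ≤ T * Y := by
                  apply mul_le_mul_of_nonneg_right _ hY
                  rw [one_mul, hTdef]
                  nlinarith [mul_nonneg hC₂0 hRp]
      -- sum over the splittings
      obtain ⟨hm, hle⟩ := memLp_list_sum_and_l2norm_le (splittings v)
        (g := fun p x => (ContinuousLinearMap.id ℝ (V →L[ℝ] G))
          (cwd p.1 (fun y => fderiv ℝ F (h y)) x) (cwd p.2 (cwd [i] h) x))
        (fun p hp => (e2 p hp).1) (fun p hp => (e2 p hp).2)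
      refine ⟨hm, hle.trans ?_⟩
      have hlen : ((splittings v).length : ℝ) ≤ 2 ^ n := by
        rw [length_splittings]
        exact_mod_cast Nat.pow_le_pow_right (by norm_num) hv
      calc ((splittings v).length : ℝ) * (T * Y) ≤ 2 ^ n * (T * Y) :=
            mul_le_mul_of_nonneg_right hlen (mul_nonneg hT0 hY)
        _ = 2 ^ n * T * Y := by ring

end Tame

end Literature.Analysis.PDE

end
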